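import Mathlib
import HarnessLib

/-!
# MEASURABLE DERIVATIVES WITH PARAMETERS, BY DIFFERENCE QUOTIENTS — joint measurability + fibrewise differentiability, NO joint continuity
# (generic; free-hands support of ⟨stmt-QuantumFields-24197⟩ `SwapVirialDeficit.SwapGluedStiffness`)

Mathlib's `measurable_deriv_with_param` asks for `Continuous f.uncurry`; iterating it to second order needs JOINT `C¹` regularity in (parameter, variable).  In the
gnomonic ring chart the hub `a ↦ ν(axisPoint a)` is continuous but not differentiable across the real axis, so for the `hAm` ∕ `det A(p)`-measurability sockets of the
bulk fibre package with a VARYING hub we use the elementary route instead: for `G : α → ℝ → ℝ` on ANY measurable space `α`,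
* ★ `measurable_deriv_param` — `(x, s) ↦ G x s` measurable and every `G x` differentiable everywhere ⟹ `(x, s) ↦ deriv (G x) s` measurable (pointwise limit of the
  measurable difference quotients `(n+1)·(G x (s + 1/(n+1)) − G x s)`, ✓`HasDerivAt.tendsto_slope_zero`, ✓`measurable_of_tendsto_metrizable`); `measurable_deriv_param_at`;
* ★ `measurable_deriv_deriv_param`, ★ `measurable_iteratedDeriv_two_param` — every `G x` of class `C²` ⟹ `(x, s) ↦ deriv (deriv (G x)) s` and
  `x ↦ iteratedDeriv 2 (G x) s₀` are measurable.
The gnomonic instance (ray derivatives of `F̂` measurable in hub, base point and direction) is the sequel `…BlowUpGnomonicRayDerivMeasurable`.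

HONEST LABEL: measure-theoretic plumbing; ⟨24197⟩ (window-uniform) ∕ ⟨24194⟩ ∕ ⟨24497⟩ OPEN; own crux ⟨22884⟩ OPEN (blocked-on ⟨19935⟩); no crux, rung of record or
summit is proved; the Yang–Mills mass gap is NOT proved; no summit is proved by a line.  THEOREMS ONLY (0 `def`, 0 `sorry`), standard axioms, Mathlib only.
Width seat ym-line-sfw-p2-w3 g66 (cell ym-idea-1, free hands), `--supports stmt-QuantumFields-24197`.  References: [folklore].
-/

set_option autoImplicit false

noncomputable section

open MeasureTheory Filter Topology Function

namespace Summit.QuantumFields.YangMills.Theorems.QuantitativeLaplace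

/-! ## §1 Measurable derivatives with parameters, by difference quotients -/

section Generic

variable {α : Type*} [MeasurableSpace α]

/-- ★ **Measurable derivative with a parameter, from joint measurability only**: if `(x, s) ↦ G x s` is measurable and every `G x` is differentiable everywhere, then
`(x, s) ↦ deriv (G x) s` is measurable (it is the pointwise limit of the measurable difference quotients `(n+1)·(G x (s + 1/(n+1)) − G x s)`). [folklore] -/
theorem measurable_deriv_param {G : α → ℝ → ℝ} (hG : Measurable fun p : α × ℝ => G p.1 p.2) (hd : ∀ x s, DifferentiableAt ℝ (G x) s) :
    Measurable fun p : α × ℝ => deriv (G p.1) p.2 := by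
  have hf : ∀ n : ℕ, Measurable fun p : α × ℝ => ((n : ℝ) + 1) * (G p.1 (p.2 + 1 / ((n : ℝ) + 1)) - G p.1 p.2) := fun n =>
    measurable_const.mul ((hG.comp (measurable_fst.prodMk (measurable_snd.add_const _))).sub hG)
  refine measurable_of_tendsto_metrizable hf ?_
  rw [tendsto_pi_nhds]
  intro p
  have ht := (hd p.1 p.2).hasDerivAt.tendsto_slope_zero
  have hu : Tendsto (fun n : ℕ => (1 : ℝ) / ((n : ℝ) + 1)) atTop (𝓝[≠] (0 : ℝ)) :=
    tendsto_nhdsWithin_iff.2 ⟨tendsto_one_div_add_atTop_nhds_zero_nat, Eventually.of_forall fun n => ne_of_gt (by positivity)⟩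
  refine (ht.comp hu).congr fun n => ?_
  simp only [Function.comp_apply, one_div, inv_inv, smul_eq_mul]

/-- ★ **Measurable second derivative with a parameter**: `(x, s) ↦ G x s` measurable and every `G x` of class `C²` ⟹ `(x, s) ↦ deriv (deriv (G x)) s` is measurable.
[folklore] -/
theorem measurable_deriv_deriv_param {G : α → ℝ → ℝ} (hG : Measurable fun p : α × ℝ => G p.1 p.2) (hd : ∀ x, ContDiff ℝ 2 (G x)) :
    Measurable fun p : α × ℝ => deriv (deriv (G p.1)) p.2 := by
  have h1 : Measurable fun p : α × ℝ => deriv (G p.1) p.2 :=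
    measurable_deriv_param hG fun x s => ((hd x).differentiable (by norm_num)).differentiableAt
  exact measurable_deriv_param (G := fun x s => deriv (G x) s) h1 fun x s => ((hd x).differentiable_deriv_two).differentiableAt

/-- ★ **Measurable `iteratedDeriv 2` with a parameter** at a fixed point `s₀`: `x ↦ iteratedDeriv 2 (G x) s₀` is measurable. [folklore] -/
theorem measurable_iteratedDeriv_two_param {G : α → ℝ → ℝ} (hG : Measurable fun p : α × ℝ => G p.1 p.2) (hd : ∀ x, ContDiff ℝ 2 (G x)) (s₀ : ℝ) :
    Measurable fun x : α => iteratedDeriv 2 (G x) s₀ := by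
  have e : (fun x : α => iteratedDeriv 2 (G x) s₀) = fun x => deriv (deriv (G x)) s₀ := by
    funext x; rw [iteratedDeriv_succ, iteratedDeriv_one]
  rw [e]
  exact (measurable_deriv_deriv_param hG hd).comp (measurable_id.prodMk measurable_const)

/-- ★ **Measurable first derivative with a parameter** at a fixed point. [folklore] -/
theorem measurable_deriv_param_at {G : α → ℝ → ℝ} (hG : Measurable fun p : α × ℝ => G p.1 p.2) (hd : ∀ x s, DifferentiableAt ℝ (G x) s) (s₀ : ℝ) :
    Measurable fun x : α => deriv (G x) s₀ :=
  (measurable_deriv_param hG hd).comp (measurable_id.prodMk measurable_const)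

end Generic

end Summit.QuantumFields.YangMills.Theorems.QuantitativeLaplace

end
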